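import Mathlib

/-!
# Clause fibre count for one round of local repair (crux stmt-PneNP-2463, line `Sketch`)

For a fixed set `F` of variables, the `k`-clauses `c : Fin k → Fin n × Bool` (literal = (variable,
sign), sign `false` = negative literal) having at least one negative literal, all of whose negative
literals sit on variables of `F`, number exactly `(n + |F|)^k - n^k`: they are the clauses with all
literals in `[n] × {true} ∪ F × {false}` (a set of `n + |F|` literals), minus the `n^k` all-positive
clauses.  We prove the equality of cardinalities and state the real-valued inequality used by the
lead's skeleton.
-/

set_option linter.dupNamespace false

namespace Summit.PneNP.PneNP.Cruxes.SolvableImpliesStableSection.Sketch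

open Finset
open scoped Classical

/-- The admissible literals: positive literals on any variable, negative literals on `F`. As a finset
this is the disjoint union `univ ×ˢ {true} ∪ F ×ˢ {false}`. -/
theorem repairClauseFibre_literals_eq (n : ℕ) (F : Finset (Fin n)) :
    ((univ : Finset (Fin n × Bool)).filter fun ℓ => ℓ.2 = false → ℓ.1 ∈ F)
      = (univ ×ˢ {true}) ∪ (F ×ˢ {false}) := by
  ext ⟨v, s⟩
  cases s <;> simp

/-- The admissible literal set has `n + |F|` elements. -/
theorem repairClauseFibre_literals_card (n : ℕ) (F : Finset (Fin n)) :
    ((univ : Finset (Fin n × Bool)).filter fun ℓ => ℓ.2 = false → ℓ.1 ∈ F).card = n + F.card := by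
  rw [repairClauseFibre_literals_eq, card_union_of_disjoint, card_product, card_product]
  · simp
  · rw [disjoint_left]
    rintro ⟨v, s⟩ h1 h2
    simp only [mem_product, mem_singleton] at h1 h2
    rw [h1.2] at h2
    exact absurd h2.2 (by decide)

/-- The positive literals `univ ×ˢ {true}` written as a filter; there are `n` of them. -/
theorem repairClauseFibre_posLiterals_card (n : ℕ) :
    ((univ : Finset (Fin n × Bool)).filter fun ℓ => ℓ.2 = true).card = n := by
  have : ((univ : Finset (Fin n × Bool)).filter fun ℓ => ℓ.2 = true) = univ ×ˢ {true} := by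
    ext ⟨v, s⟩
    cases s <;> simp
  rw [this, card_product]
  simp

/-- **The clause fibre, exact count.** The clauses with at least one negative literal, all of whose
negative literals sit on `F`, number exactly `(n + |F|)^k - n^k`. -/
theorem repairClauseFibre_card_eq (k n : ℕ) (F : Finset (Fin n)) :
    ((univ : Finset (Fin k → Fin n × Bool)).filter fun c =>
        (∃ j, (c j).2 = false) ∧ ∀ j, (c j).2 = false → (c j).1 ∈ F).card
      = (n + F.card) ^ k - n ^ k := by
  set T : Finset (Fin n × Bool) := univ.filter fun ℓ => ℓ.2 = false → ℓ.1 ∈ F with hT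
  set P : Finset (Fin n × Bool) := univ.filter fun ℓ => ℓ.2 = true with hP
  have hA : ((univ : Finset (Fin k → Fin n × Bool)).filter fun c =>
        (∃ j, (c j).2 = false) ∧ ∀ j, (c j).2 = false → (c j).1 ∈ F)
      = Fintype.piFinset (fun _ : Fin k => T) \ Fintype.piFinset (fun _ : Fin k => P) := by
    ext c
    simp only [mem_filter, mem_univ, true_and, mem_sdiff, Fintype.mem_piFinset, hT, hP, not_forall,
      Bool.not_eq_true]
    exact ⟨fun h => ⟨h.2, h.1⟩, fun h => ⟨h.2, h.1⟩⟩
  have hsub : Fintype.piFinset (fun _ : Fin k => P) ⊆ Fintype.piFinset (fun _ : Fin k => T) := by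
    refine Fintype.piFinset_subset _ _ fun _ => ?_
    intro ℓ hℓ
    simp only [hP, hT, mem_filter, mem_univ, true_and] at hℓ ⊢
    intro h
    rw [hℓ] at h
    exact absurd h (by decide)
  rw [hA, card_sdiff_of_subset hsub, Fintype.card_piFinset_const, Fintype.card_piFinset_const, hT,
    repairClauseFibre_literals_card, hP, repairClauseFibre_posLiterals_card]

/-- **Stub 3 — the clause fibre.** For a fixed set `F` of variables, the clauses `c` with at least one
negative literal all of whose negative literals sit on variables of `F` number exactly
`(n + |F|)^k - n^k` (literals in `{true} × [n] ∪ {false} × F`, minus the all-positive clauses); in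
particular their number is at most `(n + |F|)^k - n^k` as real numbers. -/
theorem stub_repairClauseFibre (k n : ℕ) (F : Finset (Fin n)) :
    (((univ : Finset (Fin k → Fin n × Bool)).filter fun c =>
        (∃ j, (c j).2 = false) ∧ ∀ j, (c j).2 = false → (c j).1 ∈ F).card : ℝ)
      ≤ ((n : ℝ) + F.card) ^ k - (n : ℝ) ^ k := by
  rw [repairClauseFibre_card_eq]
  have hle : n ^ k ≤ (n + F.card) ^ k := Nat.pow_le_pow_left (Nat.le_add_right n F.card) k
  rw [Nat.cast_sub hle]
  push_cast
  exact le_rfl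

end Summit.PneNP.PneNP.Cruxes.SolvableImpliesStableSection.Sketch
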